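import Literature.MathematicalPhysics.QuantumFieldTheory.Balaban1983to89.B8Prop5JoinSectELocalRDW
import Literature.MathematicalPhysics.QuantumFieldTheory.Balaban1983to89.B8Prop5WitnessOfDatum
import Literature.MathematicalPhysics.QuantumFieldTheory.Balaban1983to89.B8SockHFPRD

/-!
# `Balaban1983to89.B8Prop5ExistsZdLan` — [Balaban1985RegularSpaces] PROPOSITION 5, EXISTENCE CLAUSE (1.107)–(1.108) p. 94, AT THE MEMBER OF
# RECORD `B8Prop5LandauDataZd.zdLan`: the ∃λ-body of `B8.Prop5Exists B₀′ B₁ (zdLan L B₁ i)` at one member and one `(α₀, α₁)` from the [4]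
# letters (RD currency), through the witness-form Sect. D∕E JOIN

statement-level skeleton of published theorems with citation tags; proofs where landed; nothing here is a claim about the Yang–Mills mass gap

PDF held: `paper:balaban1985-cmp99-regular-spaces-gauge-fixing` (journal page = PDF page + 74); pp. 88–89 [PDF 14–15], 93–95 [PDF 19–21].

## THE PRINTED TEXT

p. 94 [PDF 20]: «**Proposition 5.** There exist positive constants c₂, c₃, depending on d and L only, such that for an arbitrary configuration
U₁ satisfying (1.69), and for the configuration u₁ determined by U₁ and satisfying (1.68), (1.73), (1.74), if α₀ + α₁ ≦ c₂, then there exists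
a configuration u′ = e^{iλ} satisfying the equations R D*(1∕iη) log U₁^{u′⁻¹} = 0, R₀\overline{u′u₁}ʲ = 1 on Λ_j, j = 0, 1, …, k (1.107) and the
bounds |λ|, |Dλ|₍₋₁₎ < 8B′₀B₁(α₀ + α₁). (1.108)»

## WHY THIS FILE (cell `pub-ymgap`, HUMAN RULING D-0062; R134 seat `pub-ymgap-dag-n05-c` g3, DAG node N05 = [B8]; `pub-ymgap-dag-n05-d` g2's
LOCATED-NEXT (L1); count-neutral)

The N05 knit of record (`Summits/…/BalabanUVNodesN05SubBKnit`) displays `p5e : B8.Prop5Exists B₀′ B₁ lan`; lit-type-B8's member of record is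
`lan := zdLan L B₁` whose datum `(u₁, A)` carries `Hyp169 = (1.33) ∧ (1.69) ∧ (1.68) ∧ (1.73)–(1.74)` and whose equations `Solves` are the Landau
condition OF RECORD (1.38) for `(e^{iηA})^{(e^{iλ})⁻¹}` and (1.29) for `u₁·e^{iλ}` — print's (1.107).  THIS FILE proves the ∃λ-BODY of that
conjunct at ONE member and ONE `(α₀, α₁)` from the [4] letters at `(k, U₀)` (DISPLAYED exactly as the JOIN's, the surviving `…_RD` currency:
`g_rightΩ`, `c_range`) and the JOIN's scalar windows (DISPLAYED one-for-one, as in `B8SockHFPRD.sockHFP_body_of_join_RD`):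
**`prop5Exists_body_zdLan_of_join`**.  CHAIN (all BY NAME): `B8Prop5WitnessOfDatum.hwit_of_hyp169` ((1.68)+(1.73)+(1.74) ⇒ unitary
`Λ_j`-witnesses, class constant `16dLB₁(α₀+α₁)`, raised to the JOIN's `α₃` by monotonicity) and `restr129_of_hyp169` ((1.68) ⇒ (1.29)) →
this file's (1.69) dictionary (`Cond169` ⇒ the JOIN's source binders `hA`, `hDA` with `c_A = L·B₁(α₀+α₁)`, `c_DA = 2dL²·B₁(α₀+α₁)`, and the
smallness `η|A| ≤ 1∕12` at the sites of `Ω₀`) → the witness-form JOIN `B8Prop5JoinSectELocalRDW.hFP_kLevel_of_sectE_local'_RD_w` at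
`Eb j := {b ∣ SideTouches (Ω_j) b}` → the Landau condition of record by `pub-ymgap-dag-n04-b`'s `B8Prop5KLevelLetters.isLandau138W_gaugeFixed_of_multiplier`
((1.86)–(1.88) at the sites of `Ω₀`, smallness read off (1.108) at level `0`, `α₄ ≤ 1∕84`) → (1.108) strict by lit-type-B8's
`B8Prop5LandauDataZd.lamNorm_lt_of_pointwise` from `α₄ < 8B′₀B₁(α₀+α₁)`.  MEMBER LAWS displayed (the «law cut» of n05-d's (L1)): `Ω` antitone
((1.3)), towers of `Λ_j` inside `Ω_j` (p. 77 «Bʲ(y) ⊂ Ω_j»), `d ≥ 2`.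

## HONEST SCOPE

By-name assembly; the [4] letters and their laws∕bounds are HYPOTHESES ([4] Thms 3.1–3.3 content); the windows are displayed, not discharged
(the `∃ c₂` sentence with the windows discharged from one guard is the next module); nothing of Proposition 5's contraction or of Sect. E is
proved here beyond composition.  (1.108) is delivered for any displayed `α₄ < 8B′₀B₁(α₀ + α₁)` meeting the windows — print's `8B′₀B₁` is not
re-derived.  Count-neutral; N05 NOT discharged; one finite `T⁴` programme at fixed `ε`; nothing continuum ∕ ℝ⁴ ∕ OS ∕ mass-gap ∕ Clay.
Unit `pub-ymgap-dag-n05-c` (g3), 2026-08-27.  Theorems only; no `sorry`, no `axiom`, no `instance`, no `notation`.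
-/

noncomputable section

open NormedSpace
open scoped BigOperators
open Complex (I)

namespace Literature.MathematicalPhysics.QuantumFieldTheory.Balaban1983to89.B8Prop5ExistsZdLan

open B7Prop1Explicit B7Prop2Explicit B7Prop1Local B7Eq92Concrete
open B7Prop2Explicit (C0 c2')
open B7Prop10General (C6 C4G)
open B7Prop9Flat (C5')
open B7Eq78Linearization (conjR zdBlocking QprimeIter)
open B7Eq170Flat (cj)
open B7Eq167Flat (InLambda Cond166 Cond167)
open B8Ineq130 (tlo thi)
open B8Ineq132 (covDerivFwd covDeriv InAk BondTouches norm_conjR)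
open B8Eq119TwistedAxial (Restr129 bgT)
open B8Eq140Level (SideTouches sideTouches_of_bondTouches)
open B8Eq184Proof (gaugeExp cfgExp)
open B8Eq182Proof (gAd)
open B8Eq188Proof (frakF3)
open B8Eq138LandauZd (IsLandau138W covDivB covLap QT)
open B8Eq178Averages (Cond168 Cond169)
open B8Ineq125Concrete (C2p)
open B8Eq1117Concrete (XSpace)
open B8Prop5ContractionKLevel (Bd2 Mc Kc)
open B8LambdaSpaceKLevel (wt)
open B8Prop5SocketDatum (sideTouches_pair_of_mem sideTouches_of_tower_bond norm_covDivB_le)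
open B8SockHFPAssembly (isSelfAdjoint_covDivB)
open B8Thm4AtLandau138 (pdevOn_tower_lt_of_inAk)
open B8Prop5KLevelLetters (isLandau138W_gaugeFixed_of_multiplier)
open B8Prop5LandauDataZd (Cond7374 ZdLanIdx zdLan lamNorm_lt_of_pointwise)
open B8Prop5WitnessOfDatum (hwit_of_hyp169 restr129_of_hyp169)
open B8Prop5JoinSectELocalRDW (hFP_kLevel_of_sectE_local'_RD_w)

-- `Site` alone could resolve to the torus sites of `Setup.lean`; re-export the `ℤ^d` sites of `B7Prop1Explicit`.
export B7Prop1Explicit (Site)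

variable {d : ℕ}

/-! ## §1 Small bookkeeping: bonds, the class constant, the vanishing derivative -/

section Small

variable {𝔸 : Type*} [CStarAlgebra 𝔸] [Nontrivial 𝔸]

omit [Nontrivial 𝔸] in
/-- In `d ≥ 2` a bond with an end-point in `S` is a side of a plaquette touching `S` (p. 77 convention). [cite: Balaban1985RegularSpaces, p.77 (convention before (1.5))] -/
theorem sideTouches_of_bondTouches_two (hd2 : 2 ≤ d) {S : Set (Site d)} {y : Site d} {τ : Fin d}
    (hb : BondTouches S y τ) : SideTouches S y τ := by
  haveI : Nontrivial (Fin d) := Fin.nontrivial_iff_two_le.mpr hd2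
  obtain ⟨κ, hκ⟩ := exists_ne τ
  exact sideTouches_of_bondTouches hκ hb

omit [Nontrivial 𝔸] in
/-- The [3]-class `Λ_j(U₀, α₃)` is monotone in its constant `α₃` (at a non-negative scale). [cite: Balaban1985Averaging, (166)–(167) p.44] -/
theorem inLambda_mono {L : ℕ} {U : Site d → Fin d → 𝔸ˣ} {u : Site d → 𝔸ˣ} {j : ℕ} {α₃ α₃' η : ℝ} (hη : 0 ≤ η)
    (hαα : α₃ ≤ α₃') (h : InLambda L U u j α₃ η) : InLambda L U u j α₃' η := by
  refine ⟨fun n hn z => (h.1 n hn z).trans hαα, fun n hn z r => (h.2 n hn z r).trans ?_⟩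
  exact mul_le_mul_of_nonneg_right (mul_le_mul_of_nonneg_right hαα (by positivity)) hη

omit [Nontrivial 𝔸] in
/-- `D^η_{U₀,μ}λ(x) = 0` when `λ(x) = λ(x + e_μ) = 0` ((1.1) is supported on the bonds touching the support of `λ`).
[cite: Balaban1985RegularSpaces, (1.1) p.76] -/
theorem covDerivFwd_eq_zero_of {η : ℝ} (U₀ : Site d → Fin d → 𝔸ˣ) (μ : Fin d) {lam : Site d → 𝔸} {x : Site d}
    (h0 : lam x = 0) (h1 : lam (x + e μ) = 0) : covDerivFwd η U₀ μ lam x = 0 := by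
  simp [covDerivFwd, h0, h1, B7Eq78Linearization.conjR]

end Small

/-! ## §2 The (1.69) dictionary: `Cond169` ⇒ the JOIN's source binders `hA`, `hDA`, and the level-`0` smallness of `A` -/

section Dict169

variable {𝔸 : Type*} [CStarAlgebra 𝔸] [Nontrivial 𝔸]
variable {L k : ℕ} {η : ℝ} {Ω : ℕ → Set (Site d)} {U₀ : Site d → Fin d → 𝔸ˣ} {A : Site d → Fin d → 𝔸} {c : ℝ}

/-- **JOIN's `hA` from (1.69)** (`c_A := L·c`): for `x ∈ Ω_j`, `j ≤ k`, and every `μ`, `Lʲη·‖A(x, μ)‖ ≤ L·c` and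
`Lʲη·‖R(U₀(x − e_μ, μ))⁻¹A(x − e_μ, μ)‖ ≤ L·c` — both bonds touch `Ω_j` at `x`; for `j < k` directly from (1.69) (`< c`), at `j = k` through
`Ω_k ⊂ Ω_{k−1}` with one factor `L` (p. 88 «we have to improve the bounds on the domain Ω_k»); unitary transport is isometric.
[cite: Balaban1985RegularSpaces, (1.69) p.88, (1.102) p.93] -/
theorem hA_of_cond169 (hL : 1 ≤ L) (hη : 0 < η) (hk : 1 ≤ k) (hΩ : ∀ j, Ω (j + 1) ⊆ Ω j)
    (hU₀ : ∀ x κ, U₀ x κ ∈ unitaryUnits 𝔸) (hc : 0 ≤ c) (h69 : Cond169 L k η Ω U₀ A c) :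
    ∀ j, j ≤ k → ∀ x ∈ Ω j, ∀ μ : Fin d,
      wt L η j * ‖A x μ‖ ≤ L * c ∧ wt L η j * ‖conjR (U₀ (x - e μ) μ)⁻¹ (A (x - e μ) μ)‖ ≤ L * c := by
  have hLr : (1 : ℝ) ≤ L := by exact_mod_cast hL
  have hU1 : ∀ x κ, U₀ x κ ∈ U1 𝔸 := fun x κ => unitaryUnits_le_U1 (hU₀ x κ)
  -- the level-`j'` bound, `j' < k`, at a bond touching `Ω_j'`, weighted
  have key : ∀ j', j' < k → ∀ (y : Site d) (τ : Fin d), BondTouches (Ω j') y τ → wt L η j' * ‖A y τ‖ ≤ c := by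
    intro j' hj' y τ hb
    have hs : 0 < (L : ℝ) ^ j' * η := B8ScaledSupNorm.scale_pos hL hη j'
    have h := ((h69 j' hj' y τ hb).1).le
    have := mul_le_mul_of_nonneg_left h hs.le
    have e : (L : ℝ) ^ j' * η * (c * ((L : ℝ) ^ j' * η)⁻¹) = c := by field_simp
    unfold wt; rwa [e] at this
  have hcL : c ≤ L * c := by nlinarith
  obtain ⟨k₀, rfl⟩ : ∃ k₀, k = k₀ + 1 := ⟨k - 1, (Nat.sub_add_cancel hk).symm⟩
  intro j hj x hx μ
  have hb₁ : ∀ j', x ∈ Ω j' → BondTouches (Ω j') x μ := fun j' h => Or.inl h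
  have hb₂ : ∀ j', x ∈ Ω j' → BondTouches (Ω j') (x - e μ) μ := fun j' h => Or.inr (by rw [sub_add_cancel]; exact h)
  rw [norm_conjR ((U1 𝔸).inv_mem (hU1 _ _))]
  rcases Nat.lt_or_ge j (k₀ + 1) with hjk | hjk
  · exact ⟨(key j hjk x μ (hb₁ j hx)).trans hcL, (key j hjk (x - e μ) μ (hb₂ j hx)).trans hcL⟩
  · obtain rfl : j = k₀ + 1 := le_antisymm hj hjk
    have hx' : x ∈ Ω k₀ := hΩ k₀ hx
    have ew : wt L η (k₀ + 1) = L * wt L η k₀ := by unfold wt; rw [pow_succ]; ring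
    have hL0 : (0 : ℝ) ≤ L := by positivity
    rw [ew, mul_assoc, mul_assoc]
    exact ⟨mul_le_mul_of_nonneg_left (key k₀ (Nat.lt_succ_self _) x μ (hb₁ k₀ hx')) hL0,
      mul_le_mul_of_nonneg_left (key k₀ (Nat.lt_succ_self _) (x - e μ) μ (hb₂ k₀ hx')) hL0⟩

/-- **JOIN's `hDA` from the gradient member of (1.69)** (`c_DA := d·L²·c`): `(Lʲη)²|(D*A)(x)| ≤ d·L²·c` for `x ∈ Ω_j`, `j ≤ k`
(`|D*A(x)| ≤ Σ_μ |D_μA_μ(x − e_μ)|`, each bond `⟨x − e_μ, x⟩` touching `Ω_j`; at `j = k` through `Ω_k ⊂ Ω_{k−1}`, `(Lᵏη)² = L²(L^{k−1}η)²`).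
[cite: Balaban1985RegularSpaces, (1.69) p.88, (1.99) p.93, p.86 (|·|₍₋₂₎)] -/
theorem bd2_covDivB_of_cond169 (hL : 1 ≤ L) (hη : 0 < η) (hk : 1 ≤ k) (hΩ : ∀ j, Ω (j + 1) ⊆ Ω j)
    (hU₀ : ∀ x κ, U₀ x κ ∈ unitaryUnits 𝔸) (hc : 0 ≤ c) (h69 : Cond169 L k η Ω U₀ A c) :
    Bd2 L η k Ω (covDivB η U₀ A) ((d : ℝ) * (L : ℝ) ^ 2 * c) := by
  have hLr : (1 : ℝ) ≤ L := by exact_mod_cast hL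
  have hL2 : (1 : ℝ) ≤ (L : ℝ) ^ 2 := one_le_pow₀ hLr
  have hU1 : ∀ x κ, U₀ x κ ∈ U1 𝔸 := fun x κ => unitaryUnits_le_U1 (hU₀ x κ)
  -- the level-`j'` bound for `j' < k`, `x ∈ Ω_j'`: `(L^{j'}η)²|D*A(x)| ≤ d·c`
  have hlev : ∀ j', j' < k → ∀ x ∈ Ω j', wt L η j' ^ 2 * ‖covDivB η U₀ A x‖ ≤ (d : ℝ) * c := by
    intro j' hj' x hx
    have hw0 : 0 ≤ wt L η j' ^ 2 := by positivity
    calc wt L η j' ^ 2 * ‖covDivB η U₀ A x‖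
        ≤ wt L η j' ^ 2 * ∑ μ : Fin d, ‖covDerivFwd η U₀ μ (fun z => A z μ) (x - e μ)‖ :=
          mul_le_mul_of_nonneg_left (norm_covDivB_le hU1 η A x) hw0
      _ = ∑ μ : Fin d, wt L η j' ^ 2 * ‖covDerivFwd η U₀ μ (fun z => A z μ) (x - e μ)‖ := Finset.mul_sum _ _ _
      _ ≤ ∑ _μ : Fin d, c := Finset.sum_le_sum fun μ _ => ?_
      _ = (d : ℝ) * c := by simp
    have hb : BondTouches (Ω j') (x - e μ) μ := Or.inr (by rw [sub_add_cancel]; exact hx)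
    have h := ((h69 j' hj' (x - e μ) μ hb).2 μ).le
    have hs : 0 < (L : ℝ) ^ j' * η := B8ScaledSupNorm.scale_pos hL hη j'
    have := mul_le_mul_of_nonneg_left h hw0
    have e : wt L η j' ^ 2 * (c * (((L : ℝ) ^ j' * η)⁻¹) ^ 2) = c := by unfold wt; field_simp
    rwa [e] at this
  have hdc : (d : ℝ) * c ≤ (d : ℝ) * (L : ℝ) ^ 2 * c := by
    have : (d : ℝ) * c * 1 ≤ (d : ℝ) * c * (L : ℝ) ^ 2 := mul_le_mul_of_nonneg_left hL2 (by positivity)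
    linarith
  obtain ⟨k₀, rfl⟩ : ∃ k₀, k = k₀ + 1 := ⟨k - 1, (Nat.sub_add_cancel hk).symm⟩
  intro j hj x hx
  rcases Nat.lt_or_ge j (k₀ + 1) with hjk | hjk
  · exact (hlev j hjk x hx).trans hdc
  · obtain rfl : j = k₀ + 1 := le_antisymm hj hjk
    have hx' : x ∈ Ω k₀ := hΩ k₀ hx
    have ew : wt L η (k₀ + 1) ^ 2 = (L : ℝ) ^ 2 * wt L η k₀ ^ 2 := by unfold wt; rw [pow_succ]; ring
    rw [ew, mul_assoc]
    calc (L : ℝ) ^ 2 * (wt L η k₀ ^ 2 * ‖covDivB η U₀ A x‖) ≤ (L : ℝ) ^ 2 * ((d : ℝ) * c) :=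
          mul_le_mul_of_nonneg_left (hlev k₀ (Nat.lt_succ_self _) x hx') (by positivity)
      _ = (d : ℝ) * (L : ℝ) ^ 2 * c := by ring

/-- **The level-`0` smallness of `A` at the sites of `Ω₀`** for the D*-identity (1.86)–(1.88): `η·‖R(U₀(x − e_μ, μ))⁻¹A(x − e_μ, μ)‖ ≤ c` for
`x ∈ Ω₀` (the bond `⟨x − e_μ, x⟩` touches `Ω₀`; (1.69) at `j = 0 < k`). [cite: Balaban1985RegularSpaces, (1.69) p.88, (1.86)–(1.88) p.91] -/
theorem eta_norm_back_le_of_cond169 (hk : 1 ≤ k) (hη : 0 < η) (hU₀ : ∀ x κ, U₀ x κ ∈ unitaryUnits 𝔸) (h69 : Cond169 L k η Ω U₀ A c) :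
    ∀ x ∈ Ω 0, ∀ μ : Fin d, η * ‖conjR (U₀ (x - e μ) μ)⁻¹ (A (x - e μ) μ)‖ ≤ c := by
  intro x hx μ
  have hU1 : U₀ (x - e μ) μ ∈ U1 𝔸 := unitaryUnits_le_U1 (hU₀ _ _)
  have hb : BondTouches (Ω 0) (x - e μ) μ := Or.inr (by rw [sub_add_cancel]; exact hx)
  have h := ((h69 0 hk (x - e μ) μ hb).1).le
  rw [pow_zero, one_mul] at h
  rw [norm_conjR ((U1 𝔸).inv_mem hU1)]
  calc η * ‖A (x - e μ) μ‖ ≤ η * (c * η⁻¹) := mul_le_mul_of_nonneg_left h hη.le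
    _ = c := by field_simp

end Dict169

/-! ## §3 PROPOSITION 5's EXISTENCE BODY AT THE MEMBER OF RECORD, from the [4] letters through the witness-form JOIN -/

section Body

variable {𝔸 : Type} [CStarAlgebra 𝔸] [Nontrivial 𝔸]

/-- **PROPOSITION 5, EXISTENCE CLAUSE (1.107)–(1.108), THE ∃λ-BODY AT THE MEMBER `zdLan L B₁ i` AND ONE `(α₀, α₁)`** — the body of the knit's
`p5e : B8.Prop5Exists B₀′ B₁ (zdLan L B₁ ·)` (cf. `B8Prop5LandauDataZd.prop5Exists_zdLan_iff`).  SETTING: a member `i` (spacing `η`, `k ≥ 1`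
levels, regions `Ω_j`, structure `Λ_j`, fixed unitary background `U₀`) obeying the MEMBER LAWS `Ω_{j+1} ⊂ Ω_j` and «Bʲ(y) ⊂ Ω_j» for `y ∈ Λ_j`,
`d ≥ 2`, `L ≥ 2`; a datum `(u₁, A)` with print's hypothesis `Hyp169 α₀ α₁` ((1.33) ∧ (1.69) ∧ (1.68) ∧ (1.73)–(1.74), constant `B₁`).  THE [4]
LETTERS at `(k, U₀)` — `g Δ q qs Aw c H′` with the inverse laws on print's domains (`g_rightΩ`, `c_range`), the readings `hΔ hqs hq hQH`, (1.92)
`hH0 hH1 hH2`, Dirichlet range and reality, (1.101) `hG`, (1.98) `hRbd` — DISPLAYED exactly as the JOIN's with `Λs := Λ`,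
`Eb j := {b ∣ SideTouches (Ω_j) b}`.  WINDOWS displayed one-for-one as the JOIN's at the scales `α₃ ≥ 16dLB₁(α₀+α₁)` (the class constant of the
witnesses), `c_A := L·B₁(α₀+α₁)`, `c_DA := 2dL²·B₁(α₀+α₁)`, a free `α₄` with `α₄ < 8B′₀B₁(α₀+α₁)`, plus `B₁(α₀+α₁) ≤ 1∕12` (the (1.86)–(1.88) smallness of
`A`; `α₄ ≤ 1∕84` follows from `200C₆·2α₄ ≤ 1`).  CONCLUSION: a parameter `λ` of the member (`Hermitian`, `= 0` off `Ω₀`, bounded with its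
derivative) SOLVING (1.107) — the Landau condition of record (1.38) for `(e^{iηA})^{(e^{iλ})⁻¹}` and (1.29) for `u₁·e^{iλ}` — with (1.108)
`lamNorm λ < 8B′₀B₁(α₀ + α₁)`.  PROOF: module docstring (witnesses of the datum → witness-form JOIN → Landau of record → norm dictionary).
[cite: Balaban1985RegularSpaces, Prop. 5 (1.107)–(1.108) p.94, (1.68)–(1.69) p.88, (1.73)–(1.74) pp.88–89, p.89, (1.86)–(1.88) p.91, (1.92)–(1.103) pp.91–93, (1.38) p.82, (1.29) p.81; Balaban1985BackgroundPropagators, Thm 3.1 p.397, (3.25) p.394] -/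
theorem prop5Exists_body_zdLan_of_join (hd2 : 2 ≤ d) {L : ℕ} (hL : 2 ≤ L) {B₁ B₀' : ℝ} (hB₁ : 0 < B₁)
    (i : ZdLanIdx d 𝔸) (hΩ : ∀ j, i.Ω (j + 1) ⊆ i.Ω j)
    (htower : ∀ j, j ≤ i.k → ∀ y ∈ i.Λ j, ∀ x, InBox (tlo L y j) (thi L y j) x → x ∈ i.Ω j)
    {α₀ α₁ : ℝ} (hα₀ : 0 < α₀) (hα₁ : 0 < α₁)
    (p : (zdLan L B₁ i).Cfg) (hp : (zdLan L B₁ i).Hyp169 α₀ α₁ p)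
    -- letters of [4] at `(k, U₀)`, `Eb j := {b | SideTouches (Ω j) b}`
    (g Δ : (Site d → 𝔸) →ₗ[ℂ] (Site d → 𝔸)) (q : (Site d → 𝔸) →ₗ[ℂ] (ℕ → Site d → 𝔸)) (qs : (ℕ → Site d → 𝔸) →ₗ[ℂ] (Site d → 𝔸))
    (Aw c : (ℕ → Site d → 𝔸) →ₗ[ℂ] (ℕ → Site d → 𝔸))
    (g_rightΩ : ∀ x, ∀ y ∈ i.Ω 0, (Δ (g x) + qs (Aw (q (g x)))) y = x y)
    (c_range : ∀ f, q (g (g (qs (c (q f))))) = q f)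
    (hΔ : ∀ (f : Site d → 𝔸), ∀ x ∈ i.Ω 0, Δ f x = covLap i.η i.U₀ ((i.Ω 0).indicator f) x)
    (hqs : ∀ (μ : ℕ → Site d → 𝔸), ∀ x ∈ i.Ω 0, qs μ x = QT L i.k i.Λ i.U₀ μ x)
    (hq : ∀ (f : Site d → 𝔸) (j : ℕ), j ≤ i.k → ∀ y ∈ i.Λ j, q f j y = QprimeIter (zdBlocking d L) (bgT L i.U₀) j f y)
    (H' : XSpace d i.k 𝔸 →ₗ[ℂ] (Site d → 𝔸)) {α₃ α₄ B₀'H B₂' : ℝ}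
    (hα3 : C0 d * α₀ ≤ 1 / 3) (hα4 : 4 * α₀ ≤ c2' d L) (ha3 : 16 * d * L * B₁ * (α₀ + α₁) ≤ α₃) (hα₄ : 0 < α₄)
    (hα₄lt : α₄ < 8 * B₀' * B₁ * (α₀ + α₁)) (hc12 : B₁ * (α₀ + α₁) ≤ 1 / 12) (hBH : 0 < B₀'H) (hB₂ : 0 ≤ B₂')
    (hH0 : ∀ (X : XSpace d i.k 𝔸) (x : Site d), ‖H' X x‖ ≤ B₀'H * ‖X‖)
    (hH1 : ∀ j, j ≤ i.k → ∀ (X : XSpace d i.k 𝔸), ∀ p ∈ {b : Site d × Fin d | SideTouches (i.Ω j) b.1 b.2},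
      wt L i.η j * ‖covDerivFwd i.η i.U₀ p.2 (H' X) p.1‖ ≤ B₀'H * ‖X‖)
    (hH2 : ∀ X : XSpace d i.k 𝔸, Bd2 L i.η i.k i.Ω (covLap i.η i.U₀ (H' X)) (B₂' * ‖X‖))
    (hHsupp : ∀ (X : XSpace d i.k 𝔸) (x : Site d), x ∉ i.Ω 0 → H' X x = 0)
    (hHequiv : ∀ X Y : XSpace d i.k 𝔸, (∀ p, Y p = -star (X p)) → ∀ x, H' Y x = -star (H' X x))
    (hQH : ∀ (Y : XSpace d i.k 𝔸) (j : ℕ) (hj : j ≤ i.k) (y : Site d), y ∈ i.Λ j →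
      QprimeIter (zdBlocking d L) (bgT L i.U₀) j (H' Y) y = Y (⟨j, Nat.lt_succ_of_le hj⟩, y))
    -- the JOIN's scalar windows, one-for-one
    (hα₃' : α₃ ≤ 1 / 200) (hs₁ : 200 * C6 d * (2 * α₄) ≤ 1) (hs₂ : 12000 * ((d : ℝ) + 1) * L * (2 * α₄) ≤ 1)
    (hs₃ : C4G d L * (α₀ + α₃ + 4 * (2 * α₄)) ≤ 1)
    (hs₄ : 1024 * ((d : ℝ) + 1) * ((d : ℝ) + 4) * L ^ 2 * α₀ ≤ 1) (hs₅ : 32 * ((d : ℝ) + 1) ^ 2 * C6 d * L ^ 2 * α₀ ≤ 1)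
    (hs₆ : 16 * d * C5' d * C6 d * (L : ℝ) ^ 2 * α₀ ≤ 1) (hs₇ : 8 * d * C6 d * L * α₀ ≤ 1)
    (hsm : α₃ + α₄ ≤ 1 / (4 * B₀'H * (2 * C2p d))) (hprod8 : 2 * C6 d * (α₃ + 4 * α₄) ≤ 1 / 8)
    {hE hE₂ lE lE₂ : ℝ} (hE_def : hE = B₀'H * (C2p d * (α₃ + α₄) * α₄)) (hE₂_def : hE₂ = B₂' * (C2p d * (α₃ + α₄) * α₄))
    (lE_def : lE = B₀'H * (4 * C2p d * (α₃ + 2 * α₄))) (lE₂_def : lE₂ = B₂' * (4 * C2p d * (α₃ + 2 * α₄)))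
    {BG BR : ℝ} (hBG : 0 ≤ BG) (hBR : 0 ≤ BR) (hcA' : L * (B₁ * (α₀ + α₁)) ≤ 1 / 13)
    (ha₁' : α₄ / 4 + hE ≤ 1 / 24) (hb₁' : α₄ / 4 + hE ≤ 1 / 140) (hθ : 10 * (α₄ / 4 + hE) * BR ≤ 1 / 2)
    (hG : ∀ (f : Site d → 𝔸) (m : ℝ), 0 ≤ m → Bd2 L i.η i.k i.Ω f m →
      (∀ x, ‖g f x‖ ≤ BG * m) ∧ ∀ j, j ≤ i.k → ∀ p ∈ {b : Site d × Fin d | SideTouches (i.Ω j) b.1 b.2},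
        wt L i.η j * ‖covDerivFwd i.η i.U₀ p.2 (g f) p.1‖ ≤ BG * m)
    (hGsupp : ∀ (f : Site d → 𝔸) (x : Site d), x ∉ i.Ω 0 → g f x = 0)
    (hGreal : ∀ f : Site d → 𝔸, (∀ j, j ≤ i.k → ∀ x ∈ i.Ω j, IsSelfAdjoint (f x)) → ∀ x, IsSelfAdjoint (g f x))
    (hRbd : ∀ (f : Site d → 𝔸) (m : ℝ), 0 ≤ m → Bd2 L i.η i.k i.Ω f m → Bd2 L i.η i.k i.Ω (f - g (qs (c (q (g f))))) (BR * m))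
    (hRreal : ∀ f : Site d → 𝔸, (∀ j, j ≤ i.k → ∀ x ∈ i.Ω j, IsSelfAdjoint (f x)) →
      ∀ j, j ≤ i.k → ∀ x ∈ i.Ω j, IsSelfAdjoint ((f - g (qs (c (q (g f))))) x))
    (h103 : BG * Mc d BR (α₄ / 4 + hE) (L * (B₁ * (α₀ + α₁))) hE₂ (2 * (d : ℝ) * (L : ℝ) ^ 2 * (B₁ * (α₀ + α₁))) ≤ α₄ / 4)
    (h106 : BG * Kc d BR (α₄ / 4 + hE) (L * (B₁ * (α₀ + α₁))) hE₂ (2 * (d : ℝ) * (L : ℝ) ^ 2 * (B₁ * (α₀ + α₁))) lE₂ (1 + lE) (1 + lE)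
      ≤ 1 / 2) :
    ∃ lam : (zdLan L B₁ i).Lam, (zdLan L B₁ i).Solves p lam ∧ (zdLan L B₁ i).lamNorm lam < 8 * B₀' * B₁ * (α₀ + α₁) := by
  have hL1 : 1 ≤ L := le_trans (by norm_num) hL
  have hd1 : 1 ≤ d := le_trans (by norm_num) hd2
  have hLr : (1 : ℝ) ≤ L := by exact_mod_cast hL1
  have hη := i.hη
  have hU₀ := i.hU₀
  have hk := i.hk
  set s := α₀ + α₁ with hs_def
  have hs0 : 0 < s := by rw [hs_def]; positivity
  have hcs0 : 0 ≤ B₁ * s := by positivity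
  have hα₃ : 0 ≤ α₃ := le_trans (by positivity) ha3
  -- the datum: (1.33), (1.69), and the witnesses ∕ (1.29) from (1.68), (1.73), (1.74)
  have h33 : InAk L i.k i.η α₀ i.Ω i.U₀ := hp.1
  have h69 : Cond169 L i.k i.η i.Ω i.U₀ p.1.2 (B₁ * (α₀ + α₁)) := hp.2.1
  have hwit16 := hwit_of_hyp169 hL1 hB₁.le i (by positivity : 0 ≤ α₀ + α₁) hp
  have hwit : ∀ j, j ≤ i.k → ∀ y ∈ i.Λ j, ∃ ut : Site d → 𝔸ˣ, (∀ x, ut x ∈ unitaryUnits 𝔸) ∧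
      InLambda L (clampCfg (tlo L y j) (thi L y j) i.U₀) ut j α₃ (((L : ℝ) ^ j)⁻¹) ∧
      ∀ x : Site d, tlo L y j ≤ x → x ≤ thi L y j → p.1.1 x = ut x := by
    intro j hj y hy
    obtain ⟨ut, hun, hW, hag⟩ := hwit16 j hj y hy
    exact ⟨ut, hun, inLambda_mono (by positivity) (by rw [hs_def] at ha3; linarith only [ha3]) hW, hag⟩
  have h129 : Restr129 L i.k i.Λ i.U₀ p.1.1 := restr129_of_hyp169 hL1 B₁ i hp
  -- (1.33) on the towers; the bond classes `Eb j`
  have h33t : ∀ j, j ≤ i.k → ∀ y ∈ i.Λ j, pdevOn (tlo L y j) (thi L y j) i.U₀ < α₀ * (((L : ℝ) ^ j)⁻¹) ^ 2 :=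
    fun j hj y hy => pdevOn_tower_lt_of_inAk hL1 hα₀ h33 hj (htower j hj y hy)
  have hEbΩ : ∀ j, j ≤ i.k → ∀ x ∈ i.Ω j, ∀ μ : Fin d,
      (x, μ) ∈ {b : Site d × Fin d | SideTouches (i.Ω j) b.1 b.2} ∧ (x - e μ, μ) ∈ {b : Site d × Fin d | SideTouches (i.Ω j) b.1 b.2} :=
    fun j _ x hx μ => sideTouches_pair_of_mem hd2 hx μ
  have hEbT : ∀ j, j ≤ i.k → ∀ y ∈ i.Λ j, ∀ (x : Site d) (κ : Fin d), InBox (tlo L y j) (thi L y j) x →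
      InBox (tlo L y j) (thi L y j) (x + e κ) → (x, κ) ∈ {b : Site d × Fin d | SideTouches (i.Ω j) b.1 b.2} :=
    fun j hj y hy x κ hx _ => sideTouches_of_tower_bond hd2 htower hj hy x κ hx
  -- the source `A`: (1.69) ⇒ `hA`, `hDA`; Hermitian
  have hA := hA_of_cond169 hL1 hη hk hΩ hU₀ hcs0 h69
  have hDA' := bd2_covDivB_of_cond169 (d := d) hL1 hη hk hΩ hU₀ hcs0 h69
  have hDA : Bd2 L i.η i.k i.Ω (fun y => covDivB i.η i.U₀ p.1.2 y) (2 * (d : ℝ) * (L : ℝ) ^ 2 * (B₁ * s)) := by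
    intro j hj x hx
    have h := hDA' j hj x hx
    have h0 : 0 ≤ (d : ℝ) * (L : ℝ) ^ 2 * (B₁ * s) := by positivity
    exact h.trans (by linarith)
  have hAsa : ∀ x μ, IsSelfAdjoint (p.1.2 x μ) := p.2.2
  have hDAsa : ∀ j, j ≤ i.k → ∀ x ∈ i.Ω j, IsSelfAdjoint (covDivB i.η i.U₀ p.1.2 x) :=
    fun _ _ x _ => isSelfAdjoint_covDivB hU₀ hAsa x
  -- THE JOIN (witness form, RD currency)
  obtain ⟨lam, hsa, hoff, h108, hmult, h129'⟩ :=
    hFP_kLevel_of_sectE_local'_RD_w (Ω := i.Ω) (Λs := i.Λ) (Eb := fun j => {b : Site d × Fin d | SideTouches (i.Ω j) b.1 b.2})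
      (U₀ := i.U₀) (A := p.1.2) (u₁ := p.1.1) hL hη hU₀ hEbΩ hEbT g Δ q qs Aw c g_rightΩ c_range hΔ hqs hq H' hα₀ hα3 hα4 hα₃ hα₄ hBH hB₂
      h33t hwit h129 hH0 hH1 hH2 hHsupp hHequiv hQH hα₃' hs₁ hs₂ hs₃ hs₄ hs₅ hs₆ hs₇ hsm hprod8 hE_def hE₂_def lE_def lE₂_def hBG hBR
      (by positivity) hcA' (by positivity) ha₁' hb₁' hθ hG hGsupp hGreal hRbd hRreal hDA hDAsa hA hAsa h103 h106
  -- the parameter as an element of the member's `Lam` (global bounds from (1.108) at level 0 and the support)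
  have hμ0 : Fin d := ⟨0, by omega⟩
  have h0 : ∀ (y : Site d) (τ : Fin d), BondTouches (i.Ω 0) y τ →
      ‖lam y‖ ≤ α₄ ∧ i.η * ‖covDerivFwd i.η i.U₀ τ lam y‖ ≤ α₄ := fun y τ hb => by
    have h := h108 0 (Nat.zero_le _) (y, τ) (sideTouches_of_bondTouches_two hd2 hb)
    simpa only [wt, pow_zero, one_mul] using h
  have hbd : ∃ C : ℝ, ∀ x, ‖lam x‖ ≤ C ∧ ∀ μ : Fin d, ‖covDerivFwd i.η i.U₀ μ lam x‖ ≤ C := by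
    refine ⟨max α₄ (α₄ / i.η), fun x => ⟨?_, fun μ => ?_⟩⟩
    · by_cases hx : x ∈ i.Ω 0
      · exact ((h0 x hμ0 (Or.inl hx)).1).trans (le_max_left _ _)
      · rw [hoff x hx, norm_zero]; exact le_trans hα₄.le (le_max_left _ _)
    · by_cases hb : BondTouches (i.Ω 0) x μ
      · have h := (h0 x μ hb).2
        have : ‖covDerivFwd i.η i.U₀ μ lam x‖ ≤ α₄ / i.η := by rw [le_div_iff₀ hη, mul_comm]; exact h
        exact this.trans (le_max_right _ _)
      · have hx : x ∉ i.Ω 0 := fun h => hb (Or.inl h)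
        have hx' : x + e μ ∉ i.Ω 0 := fun h => hb (Or.inr h)
        rw [covDerivFwd_eq_zero_of i.U₀ μ (hoff x hx) (hoff _ hx'), norm_zero]
        exact le_trans hα₄.le (le_max_left _ _)
  let lamL : (zdLan L B₁ i).Lam := ⟨lam, hsa, hoff, hbd⟩
  -- the Landau condition OF RECORD for `(e^{iηA})^{(e^{iλ})⁻¹}` from the multiplier clause ((1.86)–(1.88) at the sites of `Ω₀`)
  have hC6 : (2 : ℝ) ≤ C6 d := by unfold C6; linarith [B7Prop10Flat.one_le_C5 (d := d)]
  have hα84 : α₄ ≤ 1 / 84 := by nlinarith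
  have hl : ∀ x ∈ i.Ω 0, ‖lam x‖ ≤ 1 / 12 := fun x hx => ((h0 x hμ0 (Or.inl hx)).1).trans (hα84.trans (by norm_num))
  have hD : ∀ x ∈ i.Ω 0, ∀ μ, i.η * ‖covDerivFwd i.η i.U₀ μ lam x‖ ≤ 1 / 70 :=
    fun x hx μ => ((h0 x μ (Or.inl hx)).2).trans (hα84.trans (by norm_num))
  have hback : ∀ x ∈ i.Ω 0, ∀ μ : Fin d, BondTouches (i.Ω 0) (x - e μ) μ := fun x hx μ => Or.inr (by rwa [sub_add_cancel])
  have ha : ∀ x ∈ i.Ω 0, ∀ μ, i.η * ‖covDeriv i.η i.U₀ μ lam x‖ ≤ 1 / 70 := fun x hx μ => by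
    rw [B8Eq151V2Divergence.norm_covDeriv_eq (unitaryUnits_le_U1 (hU₀ _ _)) lam]
    exact ((h0 _ μ (hback x hx μ)).2).trans (hα84.trans (by norm_num))
  have hY : ∀ x ∈ i.Ω 0, ∀ μ, i.η * ‖conjR (i.U₀ (x - e μ) μ)⁻¹ (p.1.2 (x - e μ) μ)‖ ≤ 1 / 12 :=
    fun x hx μ => (eta_norm_back_le_of_cond169 hk hη hU₀ h69 x hx μ).trans hc12
  have hLan : IsLandau138W L i.k i.η (i.Ω 0) i.Λ i.U₀ (mgauge i.U₀ (gaugeExp lam)⁻¹ (cfgExp i.η p.1.2)) :=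
    isLandau138W_gaugeFixed_of_multiplier hη L i.k (i.Ω 0) i.Λ i.U₀ p.1.2 hl hD ha hY hmult
  -- (1.108), strict, by the norm dictionary
  have hnorm : (zdLan L B₁ i).lamNorm lamL < 8 * B₀' * B₁ * (α₀ + α₁) := by
    refine lamNorm_lt_of_pointwise L B₁ i hL1 lamL hα₄.le hα₄lt (fun j hj x hx => ?_) (fun j hj x μ hb => ?_)
    · have hjk : j ≤ i.k := hj.trans (Nat.sub_le _ _)
      exact (h108 j hjk (x, hμ0) (hEbΩ j hjk x hx hμ0).1).1
    · have hjk : j ≤ i.k := hj.trans (Nat.sub_le _ _)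
      have h := (h108 j hjk (x, μ) (sideTouches_of_bondTouches_two hd2 hb)).2
      simpa only [wt] using h
  exact ⟨lamL, ⟨hLan, h129'⟩, hnorm⟩

end Body

/-! ## §4 (v1.1) THE `∃ c₂` SENTENCE: `B8.Prop5Exists B₀′ B₁ (zdLan L B₁ ∘ ι)` over a law-cut index, windows discharged from ONE guard -/

section Sentence

open B8SockHFPWindows (hfpWindows_of_guard)

variable {𝔸 : Type} [CStarAlgebra 𝔸] [Nontrivial 𝔸]

/-- **PROPOSITION 5, EXISTENCE CLAUSE, AS THE KNIT'S CONJUNCT `p5e`** — `B8.Prop5Exists B₀′ B₁ (fun a => zdLan L B₁ (ι a))` for a family of members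
`ι : J → ZdLanIdx` obeying the member laws (`Ω_{j+1} ⊂ Ω_j`, «Bʲ(y) ⊂ Ω_j», `d ≥ 2`, `L ≥ 2`), from the [4] letters in the RD currency AT EVERY MEMBER
(`(k, Λ, U₀)` of the member; the 17 laws∕readings∕bounds of `B8SockLettersRD.SockLettersRD`'s body, constants `B_G, B_R, B₀′_H, B₂′`, below a
threshold `c_L` on `α₀`): «There exist positive constants c₂ … if α₀ + α₁ ≦ c₂, then there exists a configuration u′ = e^{iλ} satisfying (1.107)
and the bounds (1.108)».  The JOIN's scalar windows are DISCHARGED from one guard by `pub-ymgap-dag-n19-b`'s `B8SockHFPWindows.hfpWindows_of_guard`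
read at `B₀ := B₁∕(5dL)` (so `c⋆ = B₁(α₀+α₁)`) and at HALF the record's `B₀′` (so `α₄ = 4B₀′B₁(α₀+α₁) < 8B₀′B₁(α₀+α₁)`, (1.108) strict); the class
constant is `α₃ := 40d·L·B₁(α₀+α₁) ≥ 16dLB₁(α₀+α₁)`.  DISPLAYED CONSTANT CONDITIONS (for the pin owner): `2 ≤ B₁` (p. 89 «B₁ not too small»; print:
`B₁ = 5dLB₀`) and the free-constant condition `3·(2dL²)·B_G·B_R ≤ B₀′∕2` (the record's `B₀′` absorbs the `D*A`-term of (1.99), p. 93).  `c₂` depends on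
`d, L, B₁, B₀′, B₀′_H, B₂′, B_G, B_R, c_L` only.  Proof: `prop5Exists_body_zdLan_of_join` fed positionally.
[cite: Balaban1985RegularSpaces, Prop. 5 (1.107)–(1.108) p.94 («There exist positive constants c₂, c₃, depending on d and L only»), p.89, (1.99)–(1.103) p.93, (1.106) p.94; Balaban1985BackgroundPropagators, Thm 3.1 p.397, (3.25) p.394] -/
theorem prop5Exists_zdLan_of_lettersRD (hd2 : 2 ≤ d) {L : ℕ} (hL : 2 ≤ L) {B₁ B₀' B₀'H B₂' BG BR cL : ℝ}
    (hB₁ : 2 ≤ B₁) (hB₀' : 0 < B₀') (hBH : 0 < B₀'H) (hB₂ : 0 ≤ B₂') (hBG : 0 ≤ BG) (hBR : 0 ≤ BR) (hcL : 0 < cL)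
    (hfree : 3 * (2 * (d : ℝ) * (L : ℝ) ^ 2) * BG * BR ≤ B₀' / 2)
    {J : Type} (ι : J → ZdLanIdx d 𝔸)
    (hΩ : ∀ a : J, ∀ j, (ι a).Ω (j + 1) ⊆ (ι a).Ω j)
    (htower : ∀ a : J, ∀ j, j ≤ (ι a).k → ∀ y ∈ (ι a).Λ j, ∀ x, InBox (tlo L y j) (thi L y j) x → x ∈ (ι a).Ω j)
    -- the [4] letters at every member, RD currency, below the threshold `cL`
    (SLet : ∀ a : J, ∀ α₀ : ℝ, 0 < α₀ → α₀ ≤ cL → InAk L (ι a).k (ι a).η α₀ (ι a).Ω (ι a).U₀ →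
      ∃ (g Δ : (Site d → 𝔸) →ₗ[ℂ] (Site d → 𝔸)) (q : (Site d → 𝔸) →ₗ[ℂ] (ℕ → Site d → 𝔸)) (qs : (ℕ → Site d → 𝔸) →ₗ[ℂ] (Site d → 𝔸))
        (Aw c : (ℕ → Site d → 𝔸) →ₗ[ℂ] (ℕ → Site d → 𝔸)) (H' : XSpace d (ι a).k 𝔸 →ₗ[ℂ] (Site d → 𝔸)),
        (∀ x, ∀ y ∈ (ι a).Ω 0, (Δ (g x) + qs (Aw (q (g x)))) y = x y) ∧ (∀ f, q (g (g (qs (c (q f))))) = q f) ∧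
        (∀ (f : Site d → 𝔸), ∀ x ∈ (ι a).Ω 0, Δ f x = covLap (ι a).η (ι a).U₀ (((ι a).Ω 0).indicator f) x) ∧
        (∀ (μ : ℕ → Site d → 𝔸), ∀ x ∈ (ι a).Ω 0, qs μ x = QT L (ι a).k (ι a).Λ (ι a).U₀ μ x) ∧
        (∀ (f : Site d → 𝔸) (j : ℕ), j ≤ (ι a).k → ∀ y ∈ (ι a).Λ j, q f j y = QprimeIter (zdBlocking d L) (bgT L (ι a).U₀) j f y) ∧
        (∀ (X : XSpace d (ι a).k 𝔸) (x : Site d), ‖H' X x‖ ≤ B₀'H * ‖X‖) ∧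
        (∀ j, j ≤ (ι a).k → ∀ (X : XSpace d (ι a).k 𝔸), ∀ p ∈ {b : Site d × Fin d | SideTouches ((ι a).Ω j) b.1 b.2},
          wt L (ι a).η j * ‖covDerivFwd (ι a).η (ι a).U₀ p.2 (H' X) p.1‖ ≤ B₀'H * ‖X‖) ∧
        (∀ X : XSpace d (ι a).k 𝔸, Bd2 L (ι a).η (ι a).k (ι a).Ω (covLap (ι a).η (ι a).U₀ (H' X)) (B₂' * ‖X‖)) ∧
        (∀ (X : XSpace d (ι a).k 𝔸) (x : Site d), x ∉ (ι a).Ω 0 → H' X x = 0) ∧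
        (∀ X Y : XSpace d (ι a).k 𝔸, (∀ p, Y p = -star (X p)) → ∀ x, H' Y x = -star (H' X x)) ∧
        (∀ (Y : XSpace d (ι a).k 𝔸) (j : ℕ) (hj : j ≤ (ι a).k) (y : Site d), y ∈ (ι a).Λ j →
          QprimeIter (zdBlocking d L) (bgT L (ι a).U₀) j (H' Y) y = Y (⟨j, Nat.lt_succ_of_le hj⟩, y)) ∧
        (∀ (f : Site d → 𝔸) (r : ℝ), 0 ≤ r → Bd2 L (ι a).η (ι a).k (ι a).Ω f r →
          (∀ x, ‖g f x‖ ≤ BG * r) ∧ ∀ j, j ≤ (ι a).k → ∀ p ∈ {b : Site d × Fin d | SideTouches ((ι a).Ω j) b.1 b.2},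
            wt L (ι a).η j * ‖covDerivFwd (ι a).η (ι a).U₀ p.2 (g f) p.1‖ ≤ BG * r) ∧
        (∀ (f : Site d → 𝔸) (x : Site d), x ∉ (ι a).Ω 0 → g f x = 0) ∧
        (∀ f : Site d → 𝔸, (∀ j, j ≤ (ι a).k → ∀ x ∈ (ι a).Ω j, IsSelfAdjoint (f x)) → ∀ x, IsSelfAdjoint (g f x)) ∧
        (∀ (f : Site d → 𝔸) (r : ℝ), 0 ≤ r → Bd2 L (ι a).η (ι a).k (ι a).Ω f r →
          Bd2 L (ι a).η (ι a).k (ι a).Ω (f - g (qs (c (q (g f))))) (BR * r)) ∧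
        (∀ f : Site d → 𝔸, (∀ j, j ≤ (ι a).k → ∀ x ∈ (ι a).Ω j, IsSelfAdjoint (f x)) →
          ∀ j, j ≤ (ι a).k → ∀ x ∈ (ι a).Ω j, IsSelfAdjoint ((f - g (qs (c (q (g f))))) x))) :
    B8.Prop5Exists B₀' B₁ (fun a : J => zdLan L B₁ (ι a)) := by
  have hL1 : 1 ≤ L := le_trans (by norm_num) hL
  have hd1 : 1 ≤ d := le_trans (by norm_num) hd2
  have hLr : (1 : ℝ) ≤ L := by exact_mod_cast hL1
  have hdr : (1 : ℝ) ≤ d := by exact_mod_cast hd1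
  have hB₁0 : 0 < B₁ := by linarith
  -- the guard at `B₀ := B₁/(5dL)`, half the record's `B₀′`
  have hB₀ : 0 < B₁ / (5 * (d : ℝ) * L) := by positivity
  have hB : 2 ≤ 5 * (d : ℝ) * L * (B₁ / (5 * (d : ℝ) * L)) := by
    have e : 5 * (d : ℝ) * L * (B₁ / (5 * (d : ℝ) * L)) = B₁ := by field_simp
    rw [e]; exact hB₁
  obtain ⟨cP, hcP, hw⟩ := hfpWindows_of_guard hd1 hL1 hB₀ (half_pos hB₀') hB hBH hB₂ hBG hBR one_pos hfree
  unfold B8.Prop5Exists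
  refine ⟨min cP cL, lt_min hcP hcL, fun a α₀ α₁ hα₀ hα₁ hs p hp => ?_⟩
  have hsP : α₀ + α₁ ≤ cP := hs.trans (min_le_left _ _)
  have hsL : α₀ ≤ cL := by linarith [hs.trans (min_le_right cP cL)]
  have hs0 : 0 < α₀ + α₁ := by positivity
  have hx0 : 0 < B₁ * (α₀ + α₁) := mul_pos hB₁0 hs0
  -- the letters at this member
  obtain ⟨g, Δ, q, qs, Aw, c, H', g_rightΩ, c_range, hΔ, hqs, hq, hH0, hH1, hH2, hHsupp, hHequiv, hQH, hG, hGsupp, hGreal, hRbd, hRreal⟩ :=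
    SLet a α₀ hα₀ hsL hp.1
  -- the windows, read at the scales of the body theorem
  have e_cs : B₁ * (α₀ + α₁) = 5 * (d : ℝ) * L * (B₁ / (5 * (d : ℝ) * L)) * (α₀ + α₁) := by field_simp
  have e_α₄ : 4 * B₀' * B₁ * (α₀ + α₁) = 8 * (B₀' / 2) * (5 * (d : ℝ) * L * (B₁ / (5 * (d : ℝ) * L))) * (α₀ + α₁) := by
    field_simp; ring
  obtain ⟨-, -, -, -, -, -, hα3, hα4, -, -, -, hα₃', hs₁, hs₂, hs₃, hs₄, hs₅, hs₆, hs₇, hsm, hprod8, hcB13, ha₁', hb₁', hθ, h103, h106⟩ :=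
    hw α₀ α₁ hα₀ hα₁ hsP (B₁ * (α₀ + α₁)) (4 * B₀' * B₁ * (α₀ + α₁)) (L * (B₁ * (α₀ + α₁)))
      (2 * (d : ℝ) * (L : ℝ) ^ 2 * (B₁ * (α₀ + α₁)))
      (B₀'H * (C2p d * (40 * d * (L * (B₁ * (α₀ + α₁))) + 4 * B₀' * B₁ * (α₀ + α₁)) * (4 * B₀' * B₁ * (α₀ + α₁))))
      (B₂' * (C2p d * (40 * d * (L * (B₁ * (α₀ + α₁))) + 4 * B₀' * B₁ * (α₀ + α₁)) * (4 * B₀' * B₁ * (α₀ + α₁))))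
      (B₀'H * (4 * C2p d * (40 * d * (L * (B₁ * (α₀ + α₁))) + 2 * (4 * B₀' * B₁ * (α₀ + α₁)))))
      (B₂' * (4 * C2p d * (40 * d * (L * (B₁ * (α₀ + α₁))) + 2 * (4 * B₀' * B₁ * (α₀ + α₁)))))
      e_cs e_α₄ rfl rfl rfl rfl rfl rfl
  -- the remaining scalar facts of the body theorem
  have ha3 : 16 * (d : ℝ) * L * B₁ * (α₀ + α₁) ≤ 40 * d * (L * (B₁ * (α₀ + α₁))) := by
    have h0 : 0 ≤ (d : ℝ) * (L * (B₁ * (α₀ + α₁))) := by positivity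
    have e : 40 * (d : ℝ) * (L * (B₁ * (α₀ + α₁))) = 16 * d * L * B₁ * (α₀ + α₁) + 24 * (d * (L * (B₁ * (α₀ + α₁)))) := by ring
    rw [e]; linarith
  have hα₄ : 0 < 4 * B₀' * B₁ * (α₀ + α₁) := by positivity
  have hα₄lt : 4 * B₀' * B₁ * (α₀ + α₁) < 8 * B₀' * B₁ * (α₀ + α₁) := by
    have : 0 < B₀' * B₁ * (α₀ + α₁) := by positivity
    linarith
  have hc12 : B₁ * (α₀ + α₁) ≤ 1 / 12 := by
    have h1 : B₁ * (α₀ + α₁) ≤ L * (B₁ * (α₀ + α₁)) := le_mul_of_one_le_left hx0.le hLr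
    linarith
  exact prop5Exists_body_zdLan_of_join hd2 hL hB₁0 (ι a) (hΩ a) (htower a) hα₀ hα₁ p hp g Δ q qs Aw c g_rightΩ c_range hΔ hqs hq H'
    hα3 hα4 ha3 hα₄ hα₄lt hc12 hBH hB₂ hH0 hH1 hH2 hHsupp hHequiv hQH hα₃' hs₁ hs₂ hs₃ hs₄ hs₅ hs₆ hs₇ hsm hprod8 rfl rfl rfl rfl hBG
    hBR hcB13 ha₁' hb₁' hθ hG hGsupp hGreal hRbd hRreal h103 h106

end Sentence

/-! ## §5 (v1.2) The sentence over the CANONICAL law-cut index `{i : ZdLanIdx ∕∕ Ω antitone ∧ towers ⊂ Ω}` — the natural pin for `ResidB8.lan` -/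

section Canonical

variable {𝔸 : Type} [CStarAlgebra 𝔸] [Nontrivial 𝔸]

/-- **PROPOSITION 5, EXISTENCE CLAUSE, OVER THE CANONICAL LAW-CUT INDEX** — `prop5Exists_zdLan_of_lettersRD` at `ι := Subtype.val` on
`{i : ZdLanIdx d 𝔸 ∕∕ (∀ j, Ω_{j+1} ⊂ Ω_j) ∧ (∀ j ≤ k, ∀ y ∈ Λ_j, Bʲ(y) ⊂ Ω_j)}`: member-generic over EVERY geometry `(η, k, {Ω_j}, Λ)` obeying (1.3) and
«Bʲ(y) ⊂ Ω_j» (p. 77) AND every unitary background `U₀` (print fixes `U₀`, p. 89 «We fix a configuration U₀»; (1.33) is `Hyp169`'s first clause) —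
the family a pin `ResidB8.lan := fun i => zdLan L B₁ i.1` would name.  Hypotheses as there ([4] RD letters at every member below `c_L`; `2 ≤ B₁`;
`3·(2dL²)·B_G·B_R ≤ B₀′∕2`). [cite: Balaban1985RegularSpaces, Prop. 5 (1.107)–(1.108) p.94, (1.3)–(1.5) p.77, p.89] -/
theorem prop5Exists_zdLanSub_of_lettersRD (hd2 : 2 ≤ d) {L : ℕ} (hL : 2 ≤ L) {B₁ B₀' B₀'H B₂' BG BR cL : ℝ}
    (hB₁ : 2 ≤ B₁) (hB₀' : 0 < B₀') (hBH : 0 < B₀'H) (hB₂ : 0 ≤ B₂') (hBG : 0 ≤ BG) (hBR : 0 ≤ BR) (hcL : 0 < cL)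
    (hfree : 3 * (2 * (d : ℝ) * (L : ℝ) ^ 2) * BG * BR ≤ B₀' / 2)
    (SLet : ∀ i : {i : ZdLanIdx d 𝔸 // (∀ j, i.Ω (j + 1) ⊆ i.Ω j) ∧
        ∀ j, j ≤ i.k → ∀ y ∈ i.Λ j, ∀ x, InBox (tlo L y j) (thi L y j) x → x ∈ i.Ω j},
      ∀ α₀ : ℝ, 0 < α₀ → α₀ ≤ cL → InAk L i.1.k i.1.η α₀ i.1.Ω i.1.U₀ →
      ∃ (g Δ : (Site d → 𝔸) →ₗ[ℂ] (Site d → 𝔸)) (q : (Site d → 𝔸) →ₗ[ℂ] (ℕ → Site d → 𝔸)) (qs : (ℕ → Site d → 𝔸) →ₗ[ℂ] (Site d → 𝔸))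
        (Aw c : (ℕ → Site d → 𝔸) →ₗ[ℂ] (ℕ → Site d → 𝔸)) (H' : XSpace d i.1.k 𝔸 →ₗ[ℂ] (Site d → 𝔸)),
        (∀ x, ∀ y ∈ i.1.Ω 0, (Δ (g x) + qs (Aw (q (g x)))) y = x y) ∧ (∀ f, q (g (g (qs (c (q f))))) = q f) ∧
        (∀ (f : Site d → 𝔸), ∀ x ∈ i.1.Ω 0, Δ f x = covLap i.1.η i.1.U₀ ((i.1.Ω 0).indicator f) x) ∧
        (∀ (μ : ℕ → Site d → 𝔸), ∀ x ∈ i.1.Ω 0, qs μ x = QT L i.1.k i.1.Λ i.1.U₀ μ x) ∧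
        (∀ (f : Site d → 𝔸) (j : ℕ), j ≤ i.1.k → ∀ y ∈ i.1.Λ j, q f j y = QprimeIter (zdBlocking d L) (bgT L i.1.U₀) j f y) ∧
        (∀ (X : XSpace d i.1.k 𝔸) (x : Site d), ‖H' X x‖ ≤ B₀'H * ‖X‖) ∧
        (∀ j, j ≤ i.1.k → ∀ (X : XSpace d i.1.k 𝔸), ∀ p ∈ {b : Site d × Fin d | SideTouches (i.1.Ω j) b.1 b.2},
          wt L i.1.η j * ‖covDerivFwd i.1.η i.1.U₀ p.2 (H' X) p.1‖ ≤ B₀'H * ‖X‖) ∧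
        (∀ X : XSpace d i.1.k 𝔸, Bd2 L i.1.η i.1.k i.1.Ω (covLap i.1.η i.1.U₀ (H' X)) (B₂' * ‖X‖)) ∧
        (∀ (X : XSpace d i.1.k 𝔸) (x : Site d), x ∉ i.1.Ω 0 → H' X x = 0) ∧
        (∀ X Y : XSpace d i.1.k 𝔸, (∀ p, Y p = -star (X p)) → ∀ x, H' Y x = -star (H' X x)) ∧
        (∀ (Y : XSpace d i.1.k 𝔸) (j : ℕ) (hj : j ≤ i.1.k) (y : Site d), y ∈ i.1.Λ j →
          QprimeIter (zdBlocking d L) (bgT L i.1.U₀) j (H' Y) y = Y (⟨j, Nat.lt_succ_of_le hj⟩, y)) ∧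
        (∀ (f : Site d → 𝔸) (r : ℝ), 0 ≤ r → Bd2 L i.1.η i.1.k i.1.Ω f r →
          (∀ x, ‖g f x‖ ≤ BG * r) ∧ ∀ j, j ≤ i.1.k → ∀ p ∈ {b : Site d × Fin d | SideTouches (i.1.Ω j) b.1 b.2},
            wt L i.1.η j * ‖covDerivFwd i.1.η i.1.U₀ p.2 (g f) p.1‖ ≤ BG * r) ∧
        (∀ (f : Site d → 𝔸) (x : Site d), x ∉ i.1.Ω 0 → g f x = 0) ∧
        (∀ f : Site d → 𝔸, (∀ j, j ≤ i.1.k → ∀ x ∈ i.1.Ω j, IsSelfAdjoint (f x)) → ∀ x, IsSelfAdjoint (g f x)) ∧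
        (∀ (f : Site d → 𝔸) (r : ℝ), 0 ≤ r → Bd2 L i.1.η i.1.k i.1.Ω f r →
          Bd2 L i.1.η i.1.k i.1.Ω (f - g (qs (c (q (g f))))) (BR * r)) ∧
        (∀ f : Site d → 𝔸, (∀ j, j ≤ i.1.k → ∀ x ∈ i.1.Ω j, IsSelfAdjoint (f x)) →
          ∀ j, j ≤ i.1.k → ∀ x ∈ i.1.Ω j, IsSelfAdjoint ((f - g (qs (c (q (g f))))) x))) :
    B8.Prop5Exists B₀' B₁ (fun i : {i : ZdLanIdx d 𝔸 // (∀ j, i.Ω (j + 1) ⊆ i.Ω j) ∧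
        ∀ j, j ≤ i.k → ∀ y ∈ i.Λ j, ∀ x, InBox (tlo L y j) (thi L y j) x → x ∈ i.Ω j} => zdLan L B₁ i.1) :=
  prop5Exists_zdLan_of_lettersRD hd2 hL hB₁ hB₀' hBH hB₂ hBG hBR hcL hfree
    (fun i : {i : ZdLanIdx d 𝔸 // (∀ j, i.Ω (j + 1) ⊆ i.Ω j) ∧
        ∀ j, j ≤ i.k → ∀ y ∈ i.Λ j, ∀ x, InBox (tlo L y j) (thi L y j) x → x ∈ i.Ω j} => i.1)
    (fun i => i.2.1) (fun i => i.2.2) SLet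

end Canonical

/-! ## §6 (v1.3) ADAPTER: n05-d's socket `SockLettersRD` at a `ZdIdx`-type member whose top structure is `Λ` feeds the per-member letters
hypothesis of §4∕§5 (the socket quantifies over all unitary backgrounds and all truncation levels; read at `U₀ := i.U₀`, `n := k`) -/

section Adapter

open B8SockLettersRD (SockLettersRD)

variable {𝔸 : Type} [CStarAlgebra 𝔸]

/-- **`SockLettersRD` ⇒ the letters hypothesis `SLet`∕`SLetL` of `prop5Exists_zdLan_of_lettersRD` at one member**: if the [4]-letters socket of record
(`B8SockLettersRD.SockLettersRD L B_G B_R B₀′_H B₂′ c_L η k Ω Λs`, n05-d) holds at the member's `(η, k, Ω)` for SOME truncation family `Λs` whose top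
structure is the member's `Λ` (`Λs k = Λ`), then at the member's fixed background `U₀` (unitary, (1.33) at `α₀`) the seventeen laws hold at `(k, Λ, U₀)` —
the socket read at `U₀ := i.U₀`, `n := k`. [cite: Balaban1985RegularSpaces, (1.91)–(1.92) p.91, (1.95)–(1.103) pp.92–93; Balaban1985BackgroundPropagators, Thm 3.1 p.397, (3.25) p.394] -/
theorem lettersAt_of_sockLettersRD {L : ℕ} {BG BR B₀'H B₂' cL : ℝ} (i : ZdLanIdx d 𝔸) {Λs : ℕ → ℕ → Set (Site d)}
    (hΛ : Λs i.k = i.Λ) (S : SockLettersRD (𝔸 := 𝔸) L BG BR B₀'H B₂' cL i.η i.k i.Ω Λs) :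
    ∀ α₀ : ℝ, 0 < α₀ → α₀ ≤ cL → InAk L i.k i.η α₀ i.Ω i.U₀ →
      ∃ (g Δ : (Site d → 𝔸) →ₗ[ℂ] (Site d → 𝔸)) (q : (Site d → 𝔸) →ₗ[ℂ] (ℕ → Site d → 𝔸)) (qs : (ℕ → Site d → 𝔸) →ₗ[ℂ] (Site d → 𝔸))
        (Aw c : (ℕ → Site d → 𝔸) →ₗ[ℂ] (ℕ → Site d → 𝔸)) (H' : XSpace d i.k 𝔸 →ₗ[ℂ] (Site d → 𝔸)),
        (∀ x, ∀ y ∈ i.Ω 0, (Δ (g x) + qs (Aw (q (g x)))) y = x y) ∧ (∀ f, q (g (g (qs (c (q f))))) = q f) ∧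
        (∀ (f : Site d → 𝔸), ∀ x ∈ i.Ω 0, Δ f x = covLap i.η i.U₀ ((i.Ω 0).indicator f) x) ∧
        (∀ (μ : ℕ → Site d → 𝔸), ∀ x ∈ i.Ω 0, qs μ x = QT L i.k i.Λ i.U₀ μ x) ∧
        (∀ (f : Site d → 𝔸) (j : ℕ), j ≤ i.k → ∀ y ∈ i.Λ j, q f j y = QprimeIter (zdBlocking d L) (bgT L i.U₀) j f y) ∧
        (∀ (X : XSpace d i.k 𝔸) (x : Site d), ‖H' X x‖ ≤ B₀'H * ‖X‖) ∧
        (∀ j, j ≤ i.k → ∀ (X : XSpace d i.k 𝔸), ∀ p ∈ {b : Site d × Fin d | SideTouches (i.Ω j) b.1 b.2},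
          wt L i.η j * ‖covDerivFwd i.η i.U₀ p.2 (H' X) p.1‖ ≤ B₀'H * ‖X‖) ∧
        (∀ X : XSpace d i.k 𝔸, Bd2 L i.η i.k i.Ω (covLap i.η i.U₀ (H' X)) (B₂' * ‖X‖)) ∧
        (∀ (X : XSpace d i.k 𝔸) (x : Site d), x ∉ i.Ω 0 → H' X x = 0) ∧
        (∀ X Y : XSpace d i.k 𝔸, (∀ p, Y p = -star (X p)) → ∀ x, H' Y x = -star (H' X x)) ∧
        (∀ (Y : XSpace d i.k 𝔸) (j : ℕ) (hj : j ≤ i.k) (y : Site d), y ∈ i.Λ j →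
          QprimeIter (zdBlocking d L) (bgT L i.U₀) j (H' Y) y = Y (⟨j, Nat.lt_succ_of_le hj⟩, y)) ∧
        (∀ (f : Site d → 𝔸) (r : ℝ), 0 ≤ r → Bd2 L i.η i.k i.Ω f r →
          (∀ x, ‖g f x‖ ≤ BG * r) ∧ ∀ j, j ≤ i.k → ∀ p ∈ {b : Site d × Fin d | SideTouches (i.Ω j) b.1 b.2},
            wt L i.η j * ‖covDerivFwd i.η i.U₀ p.2 (g f) p.1‖ ≤ BG * r) ∧
        (∀ (f : Site d → 𝔸) (x : Site d), x ∉ i.Ω 0 → g f x = 0) ∧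
        (∀ f : Site d → 𝔸, (∀ j, j ≤ i.k → ∀ x ∈ i.Ω j, IsSelfAdjoint (f x)) → ∀ x, IsSelfAdjoint (g f x)) ∧
        (∀ (f : Site d → 𝔸) (r : ℝ), 0 ≤ r → Bd2 L i.η i.k i.Ω f r →
          Bd2 L i.η i.k i.Ω (f - g (qs (c (q (g f))))) (BR * r)) ∧
        (∀ f : Site d → 𝔸, (∀ j, j ≤ i.k → ∀ x ∈ i.Ω j, IsSelfAdjoint (f x)) →
          ∀ j, j ≤ i.k → ∀ x ∈ i.Ω j, IsSelfAdjoint ((f - g (qs (c (q (g f))))) x)) := by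
  rw [← hΛ]
  intro α₀ hα₀ hcL h33
  exact S α₀ hα₀ hcL i.U₀ i.hU₀ h33 i.k i.hk le_rfl

end Adapter

/-! ## §7 (v1.4) The sentence over the THREE-LAW canonical index `{i ∕∕ Ω₀ = ℤᵈ ∧ Ω antitone ∧ towers ⊂ Ω}` — ONE pin for p5e AND p5u
(`pub-ymgap-dag-n05-d` g3's uniqueness twin `B8Prop5UniqueZdLan.prop5Unique_zdLan_of_lettersUB` reads the extra law `Ω 0 = Set.univ`; INBOX COORDINATION (α)) -/

section Canonical3

variable {𝔸 : Type} [CStarAlgebra 𝔸] [Nontrivial 𝔸]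

/-- **PROPOSITION 5, EXISTENCE CLAUSE, OVER THE THREE-LAW CANONICAL INDEX** `{i : ZdLanIdx ∕∕ i.Ω 0 = univ ∧ (∀ n, Ω_{n+1} ⊂ Ω_n) ∧ (towers ⊂ Ω)}` —
`prop5Exists_zdLan_of_lettersRD` at `ι := Subtype.val` (the first law, `Ω₀ = ℤᵈ` = the carrier convention of the family of record `zdGF`, is not used by the
existence clause; it is displayed so that the SAME subtype serves the uniqueness twin).  Hypotheses as in §4.
[cite: Balaban1985RegularSpaces, Prop. 5 (1.107)–(1.108) p.94, (1.3)–(1.5) p.77, p.89] -/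
theorem prop5Exists_zdLanSub3_of_lettersRD (hd2 : 2 ≤ d) {L : ℕ} (hL : 2 ≤ L) {B₁ B₀' B₀'H B₂' BG BR cL : ℝ}
    (hB₁ : 2 ≤ B₁) (hB₀' : 0 < B₀') (hBH : 0 < B₀'H) (hB₂ : 0 ≤ B₂') (hBG : 0 ≤ BG) (hBR : 0 ≤ BR) (hcL : 0 < cL)
    (hfree : 3 * (2 * (d : ℝ) * (L : ℝ) ^ 2) * BG * BR ≤ B₀' / 2)
    (SLet : ∀ i : {i : ZdLanIdx d 𝔸 // i.Ω 0 = Set.univ ∧ (∀ j, i.Ω (j + 1) ⊆ i.Ω j) ∧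
        ∀ j, j ≤ i.k → ∀ y ∈ i.Λ j, ∀ x, InBox (tlo L y j) (thi L y j) x → x ∈ i.Ω j},
      ∀ α₀ : ℝ, 0 < α₀ → α₀ ≤ cL → InAk L i.1.k i.1.η α₀ i.1.Ω i.1.U₀ →
      ∃ (g Δ : (Site d → 𝔸) →ₗ[ℂ] (Site d → 𝔸)) (q : (Site d → 𝔸) →ₗ[ℂ] (ℕ → Site d → 𝔸)) (qs : (ℕ → Site d → 𝔸) →ₗ[ℂ] (Site d → 𝔸))
        (Aw c : (ℕ → Site d → 𝔸) →ₗ[ℂ] (ℕ → Site d → 𝔸)) (H' : XSpace d i.1.k 𝔸 →ₗ[ℂ] (Site d → 𝔸)),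
        (∀ x, ∀ y ∈ i.1.Ω 0, (Δ (g x) + qs (Aw (q (g x)))) y = x y) ∧ (∀ f, q (g (g (qs (c (q f))))) = q f) ∧
        (∀ (f : Site d → 𝔸), ∀ x ∈ i.1.Ω 0, Δ f x = covLap i.1.η i.1.U₀ ((i.1.Ω 0).indicator f) x) ∧
        (∀ (μ : ℕ → Site d → 𝔸), ∀ x ∈ i.1.Ω 0, qs μ x = QT L i.1.k i.1.Λ i.1.U₀ μ x) ∧
        (∀ (f : Site d → 𝔸) (j : ℕ), j ≤ i.1.k → ∀ y ∈ i.1.Λ j, q f j y = QprimeIter (zdBlocking d L) (bgT L i.1.U₀) j f y) ∧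
        (∀ (X : XSpace d i.1.k 𝔸) (x : Site d), ‖H' X x‖ ≤ B₀'H * ‖X‖) ∧
        (∀ j, j ≤ i.1.k → ∀ (X : XSpace d i.1.k 𝔸), ∀ p ∈ {b : Site d × Fin d | SideTouches (i.1.Ω j) b.1 b.2},
          wt L i.1.η j * ‖covDerivFwd i.1.η i.1.U₀ p.2 (H' X) p.1‖ ≤ B₀'H * ‖X‖) ∧
        (∀ X : XSpace d i.1.k 𝔸, Bd2 L i.1.η i.1.k i.1.Ω (covLap i.1.η i.1.U₀ (H' X)) (B₂' * ‖X‖)) ∧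
        (∀ (X : XSpace d i.1.k 𝔸) (x : Site d), x ∉ i.1.Ω 0 → H' X x = 0) ∧
        (∀ X Y : XSpace d i.1.k 𝔸, (∀ p, Y p = -star (X p)) → ∀ x, H' Y x = -star (H' X x)) ∧
        (∀ (Y : XSpace d i.1.k 𝔸) (j : ℕ) (hj : j ≤ i.1.k) (y : Site d), y ∈ i.1.Λ j →
          QprimeIter (zdBlocking d L) (bgT L i.1.U₀) j (H' Y) y = Y (⟨j, Nat.lt_succ_of_le hj⟩, y)) ∧
        (∀ (f : Site d → 𝔸) (r : ℝ), 0 ≤ r → Bd2 L i.1.η i.1.k i.1.Ω f r →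
          (∀ x, ‖g f x‖ ≤ BG * r) ∧ ∀ j, j ≤ i.1.k → ∀ p ∈ {b : Site d × Fin d | SideTouches (i.1.Ω j) b.1 b.2},
            wt L i.1.η j * ‖covDerivFwd i.1.η i.1.U₀ p.2 (g f) p.1‖ ≤ BG * r) ∧
        (∀ (f : Site d → 𝔸) (x : Site d), x ∉ i.1.Ω 0 → g f x = 0) ∧
        (∀ f : Site d → 𝔸, (∀ j, j ≤ i.1.k → ∀ x ∈ i.1.Ω j, IsSelfAdjoint (f x)) → ∀ x, IsSelfAdjoint (g f x)) ∧
        (∀ (f : Site d → 𝔸) (r : ℝ), 0 ≤ r → Bd2 L i.1.η i.1.k i.1.Ω f r →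
          Bd2 L i.1.η i.1.k i.1.Ω (f - g (qs (c (q (g f))))) (BR * r)) ∧
        (∀ f : Site d → 𝔸, (∀ j, j ≤ i.1.k → ∀ x ∈ i.1.Ω j, IsSelfAdjoint (f x)) →
          ∀ j, j ≤ i.1.k → ∀ x ∈ i.1.Ω j, IsSelfAdjoint ((f - g (qs (c (q (g f))))) x))) :
    B8.Prop5Exists B₀' B₁ (fun i : {i : ZdLanIdx d 𝔸 // i.Ω 0 = Set.univ ∧ (∀ j, i.Ω (j + 1) ⊆ i.Ω j) ∧
        ∀ j, j ≤ i.k → ∀ y ∈ i.Λ j, ∀ x, InBox (tlo L y j) (thi L y j) x → x ∈ i.Ω j} => zdLan L B₁ i.1) :=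
  prop5Exists_zdLan_of_lettersRD hd2 hL hB₁ hB₀' hBH hB₂ hBG hBR hcL hfree
    (fun i : {i : ZdLanIdx d 𝔸 // i.Ω 0 = Set.univ ∧ (∀ j, i.Ω (j + 1) ⊆ i.Ω j) ∧
        ∀ j, j ≤ i.k → ∀ y ∈ i.Λ j, ∀ x, InBox (tlo L y j) (thi L y j) x → x ∈ i.Ω j} => i.1)
    (fun i => i.2.2.1) (fun i => i.2.2.2) SLet

end Canonical3

end Literature.MathematicalPhysics.QuantumFieldTheory.Balaban1983to89.B8Prop5ExistsZdLan

end
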